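import Summits.QuantumFields.YangMills.Theorems.FluctuationComparisonRegPrIntLOrganTangentILawKerV3OfScoreProfile
import Summits.QuantumFields.YangMills.Theorems.FluctuationComparisonRegPrIntLOrganTangentILawKerLOfScoreProfile
import HarnessLib

/-!
# Crux `FluctuationComparisonRegPrIntL` (stmt-QuantumFields-20520, rung R3), PATH-B organ, H-currency cone — (L48b) «KER′ OF THE (I-law-V4)sq BLOCK BY THE REAL ROAD, DIFFERENCE
# FORM»: the kernel `kV₄` of the SQUARE organ FROM the third central moment kernel at the far corner-path × the MIXED-SCORE profile, PLUS the law-point INCREMENT of the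
# third-cumulant functional along the `B′`-edge × the score profile (the cubic twin of ✓`…OrganTangentILawKerLOfScoreProfile` (L48a); px5 g22 §81 (R-real))

Cell `ym3-torus` (YM ladder rung R3 = continuum `SU(2)` Yang–Mills on the three-torus — a RUNG: NOT d = 4, NOT infinite volume, NOT a mass gap, NOT Clay).
Width seat `ym-ust-20520-w5` (gen 25), `--kind proof --supports stmt-QuantumFields-20520 --as helper`, count-neutral, DEFINITION-FREE, default heartbeats,
no registry ∕ binder ∕ `Lines/` edit.  Over ✓`…OrganTangentILawKerV3OfScoreProfile` (`kappa3_eq_integral_centred`), ✓`…OrganTangentILawKerLOfScoreProfile`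
(`rowMass_term₁_le`, `rowMass_term₂_le`), ✓`…RunpairOrganFibreLawDefs` (`wNum`).

WHY.  The KER′ half of the (I-law-V4)sq block of row-sq v0.3 ∕ v0.4 (✓`…OrganTangentLawClausesOfILawAE` `hIlawV4`) lives on the relational SQUARE `X s s′` and reads, at a.e.
`s ∈ [0,1]`, with the FIXED observable `h := h_Ts∘Φ(V00,·)` taken TWICE, `Sc^{s′}_s` the score in the `m`-direction on the `s′`-path and `E^{s′} := ∫ · Law_t(X s s′)`:
`|κ₃¹(h, h, Sc¹_s) − κ₃⁰(h, h, Sc⁰_s)| ≤ kV₄ B B′·(‖m‖∕θc)·(‖m′‖∕θc)`, `κ₃` DISPLAYED through un-centred moments as `(E(PQR) − E(PQ)·E R) − ((E(PR) − E P·E R)·E Q + E P·(E(QR) − E Q·E R))`.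
The real road takes the `s′`-increment apart WITHOUT differentiating in `s′`: the display is linear in its third slot (§0 `kappa3_sub_slot`), so
`κ₃¹(h,h,Sc¹) − κ₃⁰(h,h,Sc⁰) = κ₃¹(h,h,Sc¹ − Sc⁰) + [κ₃¹ − κ₃⁰](h,h,Sc⁰)`; the first term is a third CENTRAL moment at `X s 1` (✓`kappa3_eq_integral_centred`) of `h, h` (profile `Kh`)
against the MIXED score increment (profile `(‖m‖∕θc)(‖m′‖∕θc)·Q₂(·;B,B′)`, letter (SC-Δ-PROF) of (L48a)); the second is the INCREMENT of the third-cumulant functional of three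
FIXED profiled observables along the `B′`-edge — letter (G₃-Δ^{prof}) with a tree kernel `𝒢₃Δ(a,b,c;B′)` and the size `‖m′‖∕θc` (print: the `s′`-integrated fourth cumulant with
the `s′`-score; bottom §76 G2-b) — SOURCES of the shapes only ([5] (3.155)–(3.156), [7] (174)–(181), [B12] p.267 for the score profiles).

WHAT.  §0 [folklore] `kappa3_sub_slot`; `kerIncrement3_abs_le` (the two-term triangle with the first term CENTRED); `sizes3_term₁_eq` ∕ `sizes3_term₂_eq`.
§1 ★★`kerV4Clause_of_cum3Kernel_increment_profiles` — ABSTRACT DOOR on the square frame: (G₃^{prof}) at `X s 1` + (G₃-Δ^{prof}) along `X s 0 → X s 1` + (h-PROF) + (SC-PROF-L)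
+ (SC-Δ-PROF) + law facts `∀ᵐ s` (normalisation + 9 integrabilities at `X s 1`) + masses of the `Kh`-DOUBLY-contracted kernels ⟹ `∃ kV₄ ≥ 0`, `t`-UNIFORM, κ-row mass
`≤ NGh·N₂ + NΔ·Nrow ≤ M` (✓`rowMass_term₁_le` ∕ ✓`rowMass_term₂_le` VERBATIM on the contracted kernels), and the KER′(V4) SHAPE with
`kV₄ B B′ := Σ_{a,c} Kh a·(Σ_b Kh b·𝒢₃ a b c)·Q₂ c B B′ + Σ_{a,c} Kh a·(Σ_b Kh b·𝒢₃Δ a b c B′)·Q₁ c B`.  §2 ★★`kerV4_organ` — the ORGAN DOCK (`Fobs := h_Ts∘Φ`,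
`Law := wNum_t ∕ ∫wNum_t`, `Sc t X′ s z := deriv (σ ↦ wNum_t (X′ σ) z) s ∕ wNum_t (X′ s) z`, `θc := θ_j∕4`): the KER′ conjunct text of `hIlawV4` VERBATIM.

HONEST FRAMING: a door between HYPOTHESIS letters; (G₃^{prof}), (G₃-Δ^{prof}), (h-PROF), (SC-PROF-L), (SC-Δ-PROF) are exactly as OPEN as KER′(V4) (bottom: §76 G2-b — volume-free
tree decay of the tilted `m`-step fibre law's third and fourth cumulants); nothing of Bałaban's analysis is asserted or proved; REG′(V4) is ✓p823910's `ilawRegSq_of_beta_of_incr`,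
not touched; (I-curv), (I-cov), `OrganDischargeInputsHJ(sq)` ∕ `SpreadFibreLawH(J)(sq)` UNDISCHARGED; the five registered stubs of `Lines/semiclassical_s2beta.lean`, crux 20520
and `YM3TorusSU2` are NOT proved; registry untouched; rung R3 = SU(2) YM₃ on T³ — NOT d = 4, NOT infinite volume, NOT a mass gap, NOT Clay; the Yang–Mills mass gap is NOT
proved.  [folklore]
-/

set_option autoImplicit false

noncomputable section

namespace Summit.QuantumFields.YangMills.Theorems.OrganTangentILawKerV4OfScoreProfile

open MeasureTheory
open scoped BigOperators
open Literature.MathematicalPhysics.QuantumFieldTheory.Balaban1983to89 T3ContinuumYM3Torus T3NestedUnitLaws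
  T3UnitLawDensityEML T4Continuum BalabanUVClass T3UnitScaleTilt T3LevelShift T3TiltDescent
open T4CubeChartExp (expPt)
open Summit.QuantumFields.YangMills.Theorems.OrganTangentILawKerV3OfScoreProfile (kappa3_eq_integral_centred)
open Summit.QuantumFields.YangMills.Theorems.OrganTangentILawKerLOfScoreProfile (rowMass_term₁_le rowMass_term₂_le)
open Summit.QuantumFields.YangMills.Theorems.FluctuationComparisonRegPrIntLRunpairOrganFibreLaw (wNum)

/-! ## §0 Folklore: third-slot linearity of the cumulant display, the increment triangle, sizes -/

section Folklore

variable {Z : Type*} [MeasurableSpace Z]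

/-- Linearity of the displayed third cumulant in its third slot. [folklore] -/
theorem kappa3_sub_slot (τ : Measure Z) (P Q R₁ R₀ L : Z → ℝ)
    (hPQR₁ : Integrable (fun z => P z * Q z * R₁ z * L z) τ) (hPQR₀ : Integrable (fun z => P z * Q z * R₀ z * L z) τ)
    (hPR₁ : Integrable (fun z => P z * R₁ z * L z) τ) (hPR₀ : Integrable (fun z => P z * R₀ z * L z) τ)
    (hQR₁ : Integrable (fun z => Q z * R₁ z * L z) τ) (hQR₀ : Integrable (fun z => Q z * R₀ z * L z) τ)
    (hR₁ : Integrable (fun z => R₁ z * L z) τ) (hR₀ : Integrable (fun z => R₀ z * L z) τ) :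
    (((∫ z, P z * Q z * R₁ z * L z ∂τ) - (∫ z, P z * Q z * L z ∂τ) * (∫ z, R₁ z * L z ∂τ))
        - (((∫ z, P z * R₁ z * L z ∂τ) - (∫ z, P z * L z ∂τ) * (∫ z, R₁ z * L z ∂τ)) * (∫ z, Q z * L z ∂τ)
            + (∫ z, P z * L z ∂τ) * ((∫ z, Q z * R₁ z * L z ∂τ) - (∫ z, Q z * L z ∂τ) * (∫ z, R₁ z * L z ∂τ))))
      - (((∫ z, P z * Q z * R₀ z * L z ∂τ) - (∫ z, P z * Q z * L z ∂τ) * (∫ z, R₀ z * L z ∂τ))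
        - (((∫ z, P z * R₀ z * L z ∂τ) - (∫ z, P z * L z ∂τ) * (∫ z, R₀ z * L z ∂τ)) * (∫ z, Q z * L z ∂τ)
            + (∫ z, P z * L z ∂τ) * ((∫ z, Q z * R₀ z * L z ∂τ) - (∫ z, Q z * L z ∂τ) * (∫ z, R₀ z * L z ∂τ))))
      = ((∫ z, P z * Q z * (R₁ z - R₀ z) * L z ∂τ) - (∫ z, P z * Q z * L z ∂τ) * (∫ z, (R₁ z - R₀ z) * L z ∂τ))
        - (((∫ z, P z * (R₁ z - R₀ z) * L z ∂τ) - (∫ z, P z * L z ∂τ) * (∫ z, (R₁ z - R₀ z) * L z ∂τ)) * (∫ z, Q z * L z ∂τ)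
            + (∫ z, P z * L z ∂τ) * ((∫ z, Q z * (R₁ z - R₀ z) * L z ∂τ) - (∫ z, Q z * L z ∂τ) * (∫ z, (R₁ z - R₀ z) * L z ∂τ))) := by
  have e1 : (∫ z, P z * Q z * (R₁ z - R₀ z) * L z ∂τ) = (∫ z, P z * Q z * R₁ z * L z ∂τ) - ∫ z, P z * Q z * R₀ z * L z ∂τ := by
    rw [← integral_sub hPQR₁ hPQR₀]; exact integral_congr_ae (ae_of_all _ fun z => by ring)
  have e2 : (∫ z, P z * (R₁ z - R₀ z) * L z ∂τ) = (∫ z, P z * R₁ z * L z ∂τ) - ∫ z, P z * R₀ z * L z ∂τ := by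
    rw [← integral_sub hPR₁ hPR₀]; exact integral_congr_ae (ae_of_all _ fun z => by ring)
  have e3 : (∫ z, Q z * (R₁ z - R₀ z) * L z ∂τ) = (∫ z, Q z * R₁ z * L z ∂τ) - ∫ z, Q z * R₀ z * L z ∂τ := by
    rw [← integral_sub hQR₁ hQR₀]; exact integral_congr_ae (ae_of_all _ fun z => by ring)
  have e4 : (∫ z, (R₁ z - R₀ z) * L z ∂τ) = (∫ z, R₁ z * L z ∂τ) - ∫ z, R₀ z * L z ∂τ := by
    rw [← integral_sub hR₁ hR₀]; exact integral_congr_ae (ae_of_all _ fun z => by ring)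
  rw [e1, e2, e3, e4]; ring

/-- **THE CUBIC INCREMENT TRIANGLE**: `|κ₃¹(P,Q,R₁) − κ₃⁰(P,Q,R₀)| ≤ |∫ (P − cP)(Q − cQ)((R₁ − R₀) − cΔ)·L¹| + |κ₃¹(P,Q,R₀) − κ₃⁰(P,Q,R₀)|` (displays as above; the first
term CENTRED under `∫ L¹ = 1`). [folklore] -/
theorem kerIncrement3_abs_le (τ : Measure Z) (P Q R₁ R₀ L₁ L₀ : Z → ℝ)
    (hL : Integrable L₁ τ) (hn : ∫ z, L₁ z ∂τ = 1) (hP : Integrable (fun z => P z * L₁ z) τ) (hQ : Integrable (fun z => Q z * L₁ z) τ)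
    (hR₁ : Integrable (fun z => R₁ z * L₁ z) τ) (hR₀ : Integrable (fun z => R₀ z * L₁ z) τ) (hPQ : Integrable (fun z => P z * Q z * L₁ z) τ)
    (hPR₁ : Integrable (fun z => P z * R₁ z * L₁ z) τ) (hPR₀ : Integrable (fun z => P z * R₀ z * L₁ z) τ)
    (hQR₁ : Integrable (fun z => Q z * R₁ z * L₁ z) τ) (hQR₀ : Integrable (fun z => Q z * R₀ z * L₁ z) τ)
    (hPQR₁ : Integrable (fun z => P z * Q z * R₁ z * L₁ z) τ) (hPQR₀ : Integrable (fun z => P z * Q z * R₀ z * L₁ z) τ)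
    {T₁ T₂ : ℝ}
    (h₁ : |∫ z, (P z - ∫ z', P z' * L₁ z' ∂τ) * (Q z - ∫ z', Q z' * L₁ z' ∂τ) * ((R₁ z - R₀ z) - ∫ z', (R₁ z' - R₀ z') * L₁ z' ∂τ) * L₁ z ∂τ| ≤ T₁)
    (h₂ : |(((∫ z, P z * Q z * R₀ z * L₁ z ∂τ) - (∫ z, P z * Q z * L₁ z ∂τ) * (∫ z, R₀ z * L₁ z ∂τ))
              - (((∫ z, P z * R₀ z * L₁ z ∂τ) - (∫ z, P z * L₁ z ∂τ) * (∫ z, R₀ z * L₁ z ∂τ)) * (∫ z, Q z * L₁ z ∂τ)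
                  + (∫ z, P z * L₁ z ∂τ) * ((∫ z, Q z * R₀ z * L₁ z ∂τ) - (∫ z, Q z * L₁ z ∂τ) * (∫ z, R₀ z * L₁ z ∂τ))))
            - (((∫ z, P z * Q z * R₀ z * L₀ z ∂τ) - (∫ z, P z * Q z * L₀ z ∂τ) * (∫ z, R₀ z * L₀ z ∂τ))
              - (((∫ z, P z * R₀ z * L₀ z ∂τ) - (∫ z, P z * L₀ z ∂τ) * (∫ z, R₀ z * L₀ z ∂τ)) * (∫ z, Q z * L₀ z ∂τ)
                  + (∫ z, P z * L₀ z ∂τ) * ((∫ z, Q z * R₀ z * L₀ z ∂τ) - (∫ z, Q z * L₀ z ∂τ) * (∫ z, R₀ z * L₀ z ∂τ))))| ≤ T₂) :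
    |(((∫ z, P z * Q z * R₁ z * L₁ z ∂τ) - (∫ z, P z * Q z * L₁ z ∂τ) * (∫ z, R₁ z * L₁ z ∂τ))
          - (((∫ z, P z * R₁ z * L₁ z ∂τ) - (∫ z, P z * L₁ z ∂τ) * (∫ z, R₁ z * L₁ z ∂τ)) * (∫ z, Q z * L₁ z ∂τ)
              + (∫ z, P z * L₁ z ∂τ) * ((∫ z, Q z * R₁ z * L₁ z ∂τ) - (∫ z, Q z * L₁ z ∂τ) * (∫ z, R₁ z * L₁ z ∂τ))))
        - (((∫ z, P z * Q z * R₀ z * L₀ z ∂τ) - (∫ z, P z * Q z * L₀ z ∂τ) * (∫ z, R₀ z * L₀ z ∂τ))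
          - (((∫ z, P z * R₀ z * L₀ z ∂τ) - (∫ z, P z * L₀ z ∂τ) * (∫ z, R₀ z * L₀ z ∂τ)) * (∫ z, Q z * L₀ z ∂τ)
              + (∫ z, P z * L₀ z ∂τ) * ((∫ z, Q z * R₀ z * L₀ z ∂τ) - (∫ z, Q z * L₀ z ∂τ) * (∫ z, R₀ z * L₀ z ∂τ))))| ≤ T₁ + T₂ := by
  have hΔ : Integrable (fun z => (R₁ z - R₀ z) * L₁ z) τ := (hR₁.sub hR₀).congr (ae_of_all _ fun z => by simp only [Pi.sub_apply]; ring)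
  have hPΔ : Integrable (fun z => P z * (R₁ z - R₀ z) * L₁ z) τ := (hPR₁.sub hPR₀).congr (ae_of_all _ fun z => by simp only [Pi.sub_apply]; ring)
  have hQΔ : Integrable (fun z => Q z * (R₁ z - R₀ z) * L₁ z) τ := (hQR₁.sub hQR₀).congr (ae_of_all _ fun z => by simp only [Pi.sub_apply]; ring)
  have hPQΔ : Integrable (fun z => P z * Q z * (R₁ z - R₀ z) * L₁ z) τ :=
    (hPQR₁.sub hPQR₀).congr (ae_of_all _ fun z => by simp only [Pi.sub_apply]; ring)
  refine (abs_sub_le _ (((∫ z, P z * Q z * R₀ z * L₁ z ∂τ) - (∫ z, P z * Q z * L₁ z ∂τ) * (∫ z, R₀ z * L₁ z ∂τ))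
      - (((∫ z, P z * R₀ z * L₁ z ∂τ) - (∫ z, P z * L₁ z ∂τ) * (∫ z, R₀ z * L₁ z ∂τ)) * (∫ z, Q z * L₁ z ∂τ)
          + (∫ z, P z * L₁ z ∂τ) * ((∫ z, Q z * R₀ z * L₁ z ∂τ) - (∫ z, Q z * L₁ z ∂τ) * (∫ z, R₀ z * L₁ z ∂τ)))) _).trans (add_le_add ?_ h₂)
  rw [kappa3_sub_slot τ P Q R₁ R₀ L₁ hPQR₁ hPQR₀ hPR₁ hPR₀ hQR₁ hQR₀ hR₁ hR₀,
    kappa3_eq_integral_centred τ P Q (fun z => R₁ z - R₀ z) L₁ hL hn hP hQ hΔ hPQ hPΔ hQΔ hPQΔ]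
  exact h₁

variable {ι ιc : Type*} [Fintype ι]

/-- Sizes out of the first cubic term (middle index contracted against `Kh`). [folklore] -/
theorem sizes3_term₁_eq (Kh : ι → ℝ) (𝒢₃ : ι → ι → ι → ℝ) (Q₂ : ι → ιc → ιc → ℝ) (hKh : ∀ a, 0 ≤ Kh a) (hQ₂ : ∀ c B B', 0 ≤ Q₂ c B B')
    (B B' : ιc) {s s' : ℝ} (hs : 0 ≤ s) (hs' : 0 ≤ s') :
    ∑ a, ∑ b, ∑ c, |Kh a| * |Kh b| * |s * s' * Q₂ c B B'| * 𝒢₃ a b c = (∑ a, ∑ c, Kh a * (∑ b, Kh b * 𝒢₃ a b c) * Q₂ c B B') * s * s' := by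
  rw [Finset.sum_mul, Finset.sum_mul]
  refine Finset.sum_congr rfl fun a _ => ?_
  rw [Finset.sum_comm, Finset.sum_mul, Finset.sum_mul]
  refine Finset.sum_congr rfl fun c _ => ?_
  rw [Finset.mul_sum, Finset.sum_mul, Finset.sum_mul, Finset.sum_mul]
  refine Finset.sum_congr rfl fun b _ => ?_
  rw [abs_of_nonneg (hKh a), abs_of_nonneg (hKh b), abs_of_nonneg (mul_nonneg (mul_nonneg hs hs') (hQ₂ c B B'))]
  ring

/-- Sizes out of the second cubic term. [folklore] -/
theorem sizes3_term₂_eq (Kh : ι → ℝ) (𝒢₃Δ : ι → ι → ι → ιc → ℝ) (Q₁ : ι → ιc → ℝ) (hKh : ∀ a, 0 ≤ Kh a) (hQ₁ : ∀ c B, 0 ≤ Q₁ c B)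
    (B B' : ιc) {s s' : ℝ} (hs : 0 ≤ s) :
    s' * ∑ a, ∑ b, ∑ c, |Kh a| * |Kh b| * |s * Q₁ c B| * 𝒢₃Δ a b c B' = (∑ a, ∑ c, Kh a * (∑ b, Kh b * 𝒢₃Δ a b c B') * Q₁ c B) * s * s' := by
  rw [Finset.mul_sum, Finset.sum_mul, Finset.sum_mul]
  refine Finset.sum_congr rfl fun a _ => ?_
  rw [Finset.sum_comm, Finset.mul_sum, Finset.sum_mul, Finset.sum_mul]
  refine Finset.sum_congr rfl fun c _ => ?_
  rw [Finset.mul_sum, Finset.mul_sum, Finset.sum_mul, Finset.sum_mul, Finset.sum_mul]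
  refine Finset.sum_congr rfl fun b _ => ?_
  rw [abs_of_nonneg (hKh a), abs_of_nonneg (hKh b), abs_of_nonneg (mul_nonneg hs (hQ₁ c B))]
  ring

end Folklore

/-! ## §1 The abstract door on the square frame -/

section Abstract

variable {P : Params} {j : ℕ} {ι : Type*} [Fintype ι] {Z : Type*} [MeasurableSpace Z]

/-- ★★ **KER′ OF THE (I-law-V4)sq BLOCK ⟸ (G₃^{prof}) × (G₃-Δ^{prof}) × (h-PROF) × (SC-PROF-L) × (SC-Δ-PROF)** — abstract currency on the relational square; see the module
docstring. [folklore] -/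
theorem kerV4Clause_of_cum3Kernel_increment_profiles (τ : Measure Z) (Fobs : GaugeField P j ↥(Matrix.specialUnitaryGroup (Fin 2) ℂ) → Z → ℝ)
    (Law : ℝ → GaugeField P j ↥(Matrix.specialUnitaryGroup (Fin 2) ℂ) → Z → ℝ)
    (Sc : ℝ → (ℝ → GaugeField P j ↥(Matrix.specialUnitaryGroup (Fin 2) ℂ)) → ℝ → Z → ℝ)
    (θc rc κ M : ℝ) (hθc : 0 < θc)
    (Prof : GaugeField P j ↥(Matrix.specialUnitaryGroup (Fin 2) ℂ) → (Z → ℝ) → (ι → ℝ) → Prop)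
    -- (G₃^{prof}) the third central moment kernel at the FAR corner-path law points `X s 1`; `Kh`-doubly-contracted column mass
    (𝒢₃ : ι → ι → ι → ℝ) (Kh : ι → ℝ) (NGh : ℝ) (hG0 : ∀ a b c, 0 ≤ 𝒢₃ a b c) (hKh0 : ∀ a, 0 ≤ Kh a) (hNGh : 0 ≤ NGh)
    (hGh : ∀ c, ∑ a, Kh a * (∑ b, Kh b * 𝒢₃ a b c) ≤ NGh)
    (hCum : ∀ t : ℝ, 0 ≤ t → t ≤ 1 → ∀ (B B' : PBond P j) (m m' : Fin 3 → ℝ) (V00 V10 V01 V11 : GaugeField P j ↥(Matrix.specialUnitaryGroup (Fin 2) ℂ)),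
      ‖m‖ ≤ rc * θc → ‖m'‖ ≤ rc * θc → PlaqSmall θc V00 → PlaqSmall θc V10 → PlaqSmall θc V01 → PlaqSmall θc V11 →
      (∀ e, e ≠ B → V10 e = V00 e) → V10 B = V00 B * expPt m → (∀ e, e ≠ B' → V01 e = V00 e) → V01 B' = V00 B' * expPt m' →
      (∀ e, e ≠ B' → V11 e = V10 e) → V11 B' = V10 B' * expPt m' →
      ∀ (Y : ℝ → GaugeField P j ↥(Matrix.specialUnitaryGroup (Fin 2) ℂ)) (X : ℝ → ℝ → GaugeField P j ↥(Matrix.specialUnitaryGroup (Fin 2) ℂ)),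
      (∀ s e, e ≠ B → Y s e = V00 e) → (∀ s, Y s B = V00 B * expPt (s • m)) → (∀ s s' e, e ≠ B' → X s s' e = Y s e) → (∀ s s', X s s' B' = Y s B' * expPt (s' • m')) →
      ∀ s ∈ Set.Icc (0:ℝ) 1, ∀ (Pf Qf Rf : Z → ℝ) (p q r : ι → ℝ), Prof (X s 1) Pf p → Prof (X s 1) Qf q → Prof (X s 1) Rf r → ∀ (cP cQ cR : ℝ),
        cP = ∫ z, Pf z * Law t (X s 1) z ∂τ → cQ = ∫ z, Qf z * Law t (X s 1) z ∂τ → cR = ∫ z, Rf z * Law t (X s 1) z ∂τ →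
          Integrable (fun z => (Pf z - cP) * (Qf z - cQ) * (Rf z - cR) * Law t (X s 1) z) τ ∧
            |∫ z, (Pf z - cP) * (Qf z - cQ) * (Rf z - cR) * Law t (X s 1) z ∂τ| ≤ ∑ a, ∑ b, ∑ c, |p a| * |q b| * |r c| * 𝒢₃ a b c)
    -- (G₃-Δ^{prof}) the INCREMENT of the displayed third cumulant of three FIXED profiled observables along the `B′`-edge `X s 0 → X s 1`; contracted edge mass
    (𝒢₃Δ : ι → ι → ι → PBond P j → ℝ) (ωY : ι → PBond P j → ℝ) (NΔ : ℝ) (hGΔ0 : ∀ a b c B', 0 ≤ 𝒢₃Δ a b c B') (hNΔ : 0 ≤ NΔ)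
    (hGΔ : ∀ c, ∑ B', (∑ a, Kh a * (∑ b, Kh b * 𝒢₃Δ a b c B')) * ωY c B' ≤ NΔ)
    (hIncr : ∀ t : ℝ, 0 ≤ t → t ≤ 1 → ∀ (B B' : PBond P j) (m m' : Fin 3 → ℝ) (V00 V10 V01 V11 : GaugeField P j ↥(Matrix.specialUnitaryGroup (Fin 2) ℂ)),
      ‖m‖ ≤ rc * θc → ‖m'‖ ≤ rc * θc → PlaqSmall θc V00 → PlaqSmall θc V10 → PlaqSmall θc V01 → PlaqSmall θc V11 →
      (∀ e, e ≠ B → V10 e = V00 e) → V10 B = V00 B * expPt m → (∀ e, e ≠ B' → V01 e = V00 e) → V01 B' = V00 B' * expPt m' →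
      (∀ e, e ≠ B' → V11 e = V10 e) → V11 B' = V10 B' * expPt m' →
      ∀ (Y : ℝ → GaugeField P j ↥(Matrix.specialUnitaryGroup (Fin 2) ℂ)) (X : ℝ → ℝ → GaugeField P j ↥(Matrix.specialUnitaryGroup (Fin 2) ℂ)),
      (∀ s e, e ≠ B → Y s e = V00 e) → (∀ s, Y s B = V00 B * expPt (s • m)) → (∀ s s' e, e ≠ B' → X s s' e = Y s e) → (∀ s s', X s s' B' = Y s B' * expPt (s' • m')) →
      ∀ s ∈ Set.Icc (0:ℝ) 1, ∀ (Pf Qf Rf : Z → ℝ) (p q r : ι → ℝ), Prof (X s 0) Pf p → Prof (X s 0) Qf q → Prof (X s 0) Rf r →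
        |((((∫ z, Pf z * Qf z * Rf z * Law t (X s 1) z ∂τ) - (∫ z, Pf z * Qf z * Law t (X s 1) z ∂τ) * (∫ z, Rf z * Law t (X s 1) z ∂τ))
                - (((∫ z, Pf z * Rf z * Law t (X s 1) z ∂τ) - (∫ z, Pf z * Law t (X s 1) z ∂τ) * (∫ z, Rf z * Law t (X s 1) z ∂τ)) * (∫ z, Qf z * Law t (X s 1) z ∂τ)
                    + (∫ z, Pf z * Law t (X s 1) z ∂τ) * ((∫ z, Qf z * Rf z * Law t (X s 1) z ∂τ) - (∫ z, Qf z * Law t (X s 1) z ∂τ) * (∫ z, Rf z * Law t (X s 1) z ∂τ)))))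
            - ((((∫ z, Pf z * Qf z * Rf z * Law t (X s 0) z ∂τ) - (∫ z, Pf z * Qf z * Law t (X s 0) z ∂τ) * (∫ z, Rf z * Law t (X s 0) z ∂τ))
                - (((∫ z, Pf z * Rf z * Law t (X s 0) z ∂τ) - (∫ z, Pf z * Law t (X s 0) z ∂τ) * (∫ z, Rf z * Law t (X s 0) z ∂τ)) * (∫ z, Qf z * Law t (X s 0) z ∂τ)
                    + (∫ z, Pf z * Law t (X s 0) z ∂τ) * ((∫ z, Qf z * Rf z * Law t (X s 0) z ∂τ) - (∫ z, Qf z * Law t (X s 0) z ∂τ) * (∫ z, Rf z * Law t (X s 0) z ∂τ)))))|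
          ≤ ‖m'‖ / θc * ∑ a, ∑ b, ∑ c, |p a| * |q b| * |r c| * 𝒢₃Δ a b c B')
    -- (SC-PROF-L) ∕ (SC-Δ-PROF): profiles of the score on the near path and of the MIXED score increment; masses
    (Q₁ : ι → PBond P j → ℝ) (Q₂ : ι → PBond P j → PBond P j → ℝ) (ωX : ι → PBond P j → ℝ) (Nrow N₂ : ℝ)
    (hQ10 : ∀ c B, 0 ≤ Q₁ c B) (hQ20 : ∀ c B B', 0 ≤ Q₂ c B B') (hωX : ∀ c B, 0 ≤ ωX c B)
    (hQcol : ∀ B, ∑ c, Q₁ c B * ωX c B ≤ Nrow) (hQ2 : ∀ B, ∑ c, ∑ B', Q₂ c B B' * Real.exp (κ * (B.src.tdist B'.src : ℝ)) ≤ N₂)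
    (htri : ∀ (B B' : PBond P j) (c : ι), Real.exp (κ * (B.src.tdist B'.src : ℝ)) ≤ ωX c B * ωY c B')
    -- (h-PROF) ∧ (SC-PROF-L) ∧ (SC-Δ-PROF) at the square law points
    (hProfF : ∀ t : ℝ, 0 ≤ t → t ≤ 1 → ∀ (B B' : PBond P j) (m m' : Fin 3 → ℝ) (V00 V10 V01 V11 : GaugeField P j ↥(Matrix.specialUnitaryGroup (Fin 2) ℂ)),
      ‖m‖ ≤ rc * θc → ‖m'‖ ≤ rc * θc → PlaqSmall θc V00 → PlaqSmall θc V10 → PlaqSmall θc V01 → PlaqSmall θc V11 →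
      (∀ e, e ≠ B → V10 e = V00 e) → V10 B = V00 B * expPt m → (∀ e, e ≠ B' → V01 e = V00 e) → V01 B' = V00 B' * expPt m' →
      (∀ e, e ≠ B' → V11 e = V10 e) → V11 B' = V10 B' * expPt m' →
      ∀ (Y : ℝ → GaugeField P j ↥(Matrix.specialUnitaryGroup (Fin 2) ℂ)) (X : ℝ → ℝ → GaugeField P j ↥(Matrix.specialUnitaryGroup (Fin 2) ℂ)),
      (∀ s e, e ≠ B → Y s e = V00 e) → (∀ s, Y s B = V00 B * expPt (s • m)) → (∀ s s' e, e ≠ B' → X s s' e = Y s e) → (∀ s s', X s s' B' = Y s B' * expPt (s' • m')) →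
      ∀ s ∈ Set.Icc (0:ℝ) 1,
        Prof (X s 1) (Fobs V00) Kh ∧ Prof (X s 0) (Fobs V00) Kh ∧ Prof (X s 0) (Sc t (fun σ => X σ 0) s) (fun a => ‖m‖ / θc * Q₁ a B) ∧
          Prof (X s 1) (fun z => Sc t (fun σ => X σ 1) s z - Sc t (fun σ => X σ 0) s z) (fun a => ‖m‖ / θc * (‖m'‖ / θc) * Q₂ a B B'))
    -- the law facts at the far corner-path law points, a.e. in the path parameter
    (hlaw : ∀ t : ℝ, 0 ≤ t → t ≤ 1 → ∀ (B B' : PBond P j) (m m' : Fin 3 → ℝ) (V00 V10 V01 V11 : GaugeField P j ↥(Matrix.specialUnitaryGroup (Fin 2) ℂ)),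
      ‖m‖ ≤ rc * θc → ‖m'‖ ≤ rc * θc → PlaqSmall θc V00 → PlaqSmall θc V10 → PlaqSmall θc V01 → PlaqSmall θc V11 →
      (∀ e, e ≠ B → V10 e = V00 e) → V10 B = V00 B * expPt m → (∀ e, e ≠ B' → V01 e = V00 e) → V01 B' = V00 B' * expPt m' →
      (∀ e, e ≠ B' → V11 e = V10 e) → V11 B' = V10 B' * expPt m' →
      ∀ (Y : ℝ → GaugeField P j ↥(Matrix.specialUnitaryGroup (Fin 2) ℂ)) (X : ℝ → ℝ → GaugeField P j ↥(Matrix.specialUnitaryGroup (Fin 2) ℂ)),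
      (∀ s e, e ≠ B → Y s e = V00 e) → (∀ s, Y s B = V00 B * expPt (s • m)) → (∀ s s' e, e ≠ B' → X s s' e = Y s e) → (∀ s s', X s s' B' = Y s B' * expPt (s' • m')) →
      ∀ᵐ s ∂(volume : Measure ℝ), s ∈ Set.Icc (0:ℝ) 1 →
        Integrable (fun z => Law t (X s 1) z) τ ∧ ∫ z, Law t (X s 1) z ∂τ = 1 ∧ Integrable (fun z => Fobs V00 z * Law t (X s 1) z) τ ∧
        Integrable (fun z => Sc t (fun σ => X σ 1) s z * Law t (X s 1) z) τ ∧ Integrable (fun z => Sc t (fun σ => X σ 0) s z * Law t (X s 1) z) τ ∧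
        Integrable (fun z => Fobs V00 z * Fobs V00 z * Law t (X s 1) z) τ ∧
        Integrable (fun z => Fobs V00 z * Sc t (fun σ => X σ 1) s z * Law t (X s 1) z) τ ∧ Integrable (fun z => Fobs V00 z * Sc t (fun σ => X σ 0) s z * Law t (X s 1) z) τ ∧
        Integrable (fun z => Fobs V00 z * Fobs V00 z * Sc t (fun σ => X σ 1) s z * Law t (X s 1) z) τ ∧ Integrable (fun z => Fobs V00 z * Fobs V00 z * Sc t (fun σ => X σ 0) s z * Law t (X s 1) z) τ)
    (hM : NGh * N₂ + NΔ * Nrow ≤ M) :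
    ∃ kV₄ : PBond P j → PBond P j → ℝ, (∀ B B', 0 ≤ kV₄ B B') ∧
      (∀ B, ∑ B', kV₄ B B' * Real.exp (κ * (B.src.tdist B'.src : ℝ)) ≤ M) ∧
      ∀ t : ℝ, 0 ≤ t → t ≤ 1 → ∀ (B B' : PBond P j) (m m' : Fin 3 → ℝ) (V00 V10 V01 V11 : GaugeField P j ↥(Matrix.specialUnitaryGroup (Fin 2) ℂ)),
        ‖m‖ ≤ rc * θc → ‖m'‖ ≤ rc * θc → PlaqSmall θc V00 → PlaqSmall θc V10 → PlaqSmall θc V01 → PlaqSmall θc V11 →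
        (∀ e, e ≠ B → V10 e = V00 e) → V10 B = V00 B * expPt m → (∀ e, e ≠ B' → V01 e = V00 e) → V01 B' = V00 B' * expPt m' →
        (∀ e, e ≠ B' → V11 e = V10 e) → V11 B' = V10 B' * expPt m' →
        ∀ (Y : ℝ → GaugeField P j ↥(Matrix.specialUnitaryGroup (Fin 2) ℂ)) (X : ℝ → ℝ → GaugeField P j ↥(Matrix.specialUnitaryGroup (Fin 2) ℂ)),
        (∀ s e, e ≠ B → Y s e = V00 e) → (∀ s, Y s B = V00 B * expPt (s • m)) → (∀ s s' e, e ≠ B' → X s s' e = Y s e) → (∀ s s', X s s' B' = Y s B' * expPt (s' • m')) →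
        ∀ᵐ s ∂(volume : Measure ℝ), s ∈ Set.Icc (0:ℝ) 1 →
          |((((∫ z, Fobs V00 z * Fobs V00 z * Sc t (fun σ => X σ 1) s z * Law t (X s 1) z ∂τ) - (∫ z, Fobs V00 z * Fobs V00 z * Law t (X s 1) z ∂τ) * (∫ z, Sc t (fun σ => X σ 1) s z * Law t (X s 1) z ∂τ))
                - (((∫ z, Fobs V00 z * Sc t (fun σ => X σ 1) s z * Law t (X s 1) z ∂τ) - (∫ z, Fobs V00 z * Law t (X s 1) z ∂τ) * (∫ z, Sc t (fun σ => X σ 1) s z * Law t (X s 1) z ∂τ)) * (∫ z, Fobs V00 z * Law t (X s 1) z ∂τ)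
                    + (∫ z, Fobs V00 z * Law t (X s 1) z ∂τ) * ((∫ z, Fobs V00 z * Sc t (fun σ => X σ 1) s z * Law t (X s 1) z ∂τ) - (∫ z, Fobs V00 z * Law t (X s 1) z ∂τ) * (∫ z, Sc t (fun σ => X σ 1) s z * Law t (X s 1) z ∂τ)))))
              - ((((∫ z, Fobs V00 z * Fobs V00 z * Sc t (fun σ => X σ 0) s z * Law t (X s 0) z ∂τ) - (∫ z, Fobs V00 z * Fobs V00 z * Law t (X s 0) z ∂τ) * (∫ z, Sc t (fun σ => X σ 0) s z * Law t (X s 0) z ∂τ))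
                - (((∫ z, Fobs V00 z * Sc t (fun σ => X σ 0) s z * Law t (X s 0) z ∂τ) - (∫ z, Fobs V00 z * Law t (X s 0) z ∂τ) * (∫ z, Sc t (fun σ => X σ 0) s z * Law t (X s 0) z ∂τ)) * (∫ z, Fobs V00 z * Law t (X s 0) z ∂τ)
                    + (∫ z, Fobs V00 z * Law t (X s 0) z ∂τ) * ((∫ z, Fobs V00 z * Sc t (fun σ => X σ 0) s z * Law t (X s 0) z ∂τ) - (∫ z, Fobs V00 z * Law t (X s 0) z ∂τ) * (∫ z, Sc t (fun σ => X σ 0) s z * Law t (X s 0) z ∂τ)))))|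
            ≤ kV₄ B B' * (‖m‖ / θc) * (‖m'‖ / θc) := by
  have hGS0 : ∀ a c, 0 ≤ ∑ b, Kh b * 𝒢₃ a b c := fun a c => Finset.sum_nonneg fun b _ => mul_nonneg (hKh0 b) (hG0 a b c)
  have hGΔS0 : ∀ a c B', 0 ≤ ∑ b, Kh b * 𝒢₃Δ a b c B' := fun a c B' => Finset.sum_nonneg fun b _ => mul_nonneg (hKh0 b) (hGΔ0 a b c B')
  refine ⟨fun B B' => (∑ a, ∑ c, Kh a * (∑ b, Kh b * 𝒢₃ a b c) * Q₂ c B B') + ∑ a, ∑ c, Kh a * (∑ b, Kh b * 𝒢₃Δ a b c B') * Q₁ c B,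
    fun B B' => ?_, fun B => ?_, ?_⟩
  · exact add_nonneg (Finset.sum_nonneg fun a _ => Finset.sum_nonneg fun c _ => mul_nonneg (mul_nonneg (hKh0 a) (hGS0 a c)) (hQ20 c B B'))
      (Finset.sum_nonneg fun a _ => Finset.sum_nonneg fun c _ => mul_nonneg (mul_nonneg (hKh0 a) (hGΔS0 a c B')) (hQ10 c B))
  · calc ∑ B', ((∑ a, ∑ c, Kh a * (∑ b, Kh b * 𝒢₃ a b c) * Q₂ c B B') + ∑ a, ∑ c, Kh a * (∑ b, Kh b * 𝒢₃Δ a b c B') * Q₁ c B)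
          * Real.exp (κ * (B.src.tdist B'.src : ℝ))
        = (∑ B', (∑ a, ∑ c, Kh a * (∑ b, Kh b * 𝒢₃ a b c) * Q₂ c B B') * Real.exp (κ * (B.src.tdist B'.src : ℝ)))
            + ∑ B', (∑ a, ∑ c, Kh a * (∑ b, Kh b * 𝒢₃Δ a b c B') * Q₁ c B) * Real.exp (κ * (B.src.tdist B'.src : ℝ)) := by
          rw [← Finset.sum_add_distrib]; exact Finset.sum_congr rfl fun B' _ => add_mul _ _ _
      _ ≤ NGh * N₂ + NΔ * Nrow :=
          add_le_add
            (rowMass_term₁_le Kh (fun a c => ∑ b, Kh b * 𝒢₃ a b c) Q₂ (fun B B' => Real.exp (κ * (B.src.tdist B'.src : ℝ))) hQ20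
              (fun B B' => (Real.exp_pos _).le) hNGh hGh B (hQ2 B))
            (rowMass_term₂_le Kh (fun a c B' => ∑ b, Kh b * 𝒢₃Δ a b c B') Q₁ (fun B B' => Real.exp (κ * (B.src.tdist B'.src : ℝ))) ωX ωY hKh0 hGΔS0
              hQ10 hωX (fun B B' c => htri B B' c) hNΔ hGΔ B (hQcol B))
      _ ≤ M := hM
  · intro t ht0 ht1 B B' m m' V00 V10 V01 V11 hm hm' h00 h10 h01 h11 h10off h10on h01off h01on h11off h11on Y X hYoff hYon hXoff hXon
    filter_upwards [hlaw t ht0 ht1 B B' m m' V00 V10 V01 V11 hm hm' h00 h10 h01 h11 h10off h10on h01off h01on h11off h11on Y X hYoff hYon hXoff hXon]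
      with s hs hsI
    obtain ⟨hLi, hLn, hFi, hS1i, hS0i, hFFi, hFS1i, hFS0i, hFFS1i, hFFS0i⟩ := hs hsI
    obtain ⟨hpF1, hpF0, hq0, hqΔ⟩ :=
      hProfF t ht0 ht1 B B' m m' V00 V10 V01 V11 hm hm' h00 h10 h01 h11 h10off h10on h01off h01on h11off h11on Y X hYoff hYon hXoff hXon s hsI
    obtain ⟨-, hbd1⟩ := hCum t ht0 ht1 B B' m m' V00 V10 V01 V11 hm hm' h00 h10 h01 h11 h10off h10on h01off h01on h11off h11on Y X hYoff hYon hXoff hXon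
      s hsI _ _ _ _ _ _ hpF1 hpF1 hqΔ _ _ _ rfl rfl rfl
    have hbd2 := hIncr t ht0 ht1 B B' m m' V00 V10 V01 V11 hm hm' h00 h10 h01 h11 h10off h10on h01off h01on h11off h11on Y X hYoff hYon hXoff hXon
      s hsI _ _ _ _ _ _ hpF0 hpF0 hq0
    have hs0 : 0 ≤ ‖m‖ / θc := div_nonneg (norm_nonneg _) hθc.le
    have hs0' : 0 ≤ ‖m'‖ / θc := div_nonneg (norm_nonneg _) hθc.le
    have key := kerIncrement3_abs_le τ (Fobs V00) (Fobs V00) (Sc t (fun σ => X σ 1) s) (Sc t (fun σ => X σ 0) s) (Law t (X s 1)) (Law t (X s 0))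
      hLi hLn hFi hFi hS1i hS0i hFFi hFS1i hFS0i hFS1i hFS0i hFFS1i hFFS0i
      (T₁ := ∑ a, ∑ b, ∑ c, |Kh a| * |Kh b| * |‖m‖ / θc * (‖m'‖ / θc) * Q₂ c B B'| * 𝒢₃ a b c)
      (T₂ := ‖m'‖ / θc * ∑ a, ∑ b, ∑ c, |Kh a| * |Kh b| * |‖m‖ / θc * Q₁ c B| * 𝒢₃Δ a b c B') hbd1 hbd2
    refine key.trans (le_of_eq ?_)
    rw [sizes3_term₁_eq Kh 𝒢₃ Q₂ hKh0 hQ20 B B' hs0 hs0', sizes3_term₂_eq Kh 𝒢₃Δ Q₁ hKh0 hQ10 B B' hs0]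
    ring

end Abstract

/-! ## §2 The organ dock: ✓p821651's `hIlawV4` KER′ conjunct text -/

section Organ

variable {ι : Type*} [Fintype ι]

/-- ★★ **THE ORGAN READING OF §1** — `Fobs := h_Ts∘Φ`, `Law t Xw z := wNum_t Xw z ∕ ∫ wNum_t Xw`, `Sc t X′ s z := deriv (σ ↦ wNum_t (X′ σ) z) s ∕ wNum_t (X′ s) z`,
`θc := θ_j∕4`: the KER′ conjunct of the (I-law-V4)sq block VERBATIM (to be paired with ✓p823910's REG′ `ilawRegSq_of_beta_of_incr`). [folklore] -/
theorem kerV4_organ (F : T3Family) (γ b₀ p₀ : ℝ) (j Ts : ℕ)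
    (ρ ρ' : (i : ℕ) → GaugeField (F.P i) 0 ↥(Matrix.specialUnitaryGroup (Fin 2) ℂ) → ℝ) {Z : Type} [MeasurableSpace Z] (τ : Measure Z)
    (Φ : GaugeField (F.P j) 0 ↥(Matrix.specialUnitaryGroup (Fin 2) ℂ) × Z → GaugeField (F.P Ts) 0 ↥(Matrix.specialUnitaryGroup (Fin 2) ℂ))
    (J : GaugeField (F.P j) 0 ↥(Matrix.specialUnitaryGroup (Fin 2) ℂ) × Z → NNReal)
    (rc κ M : ℝ) (hθ : 0 < θBal F.L γ b₀ p₀ j)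
    (Prof : GaugeField (F.P j) 0 ↥(Matrix.specialUnitaryGroup (Fin 2) ℂ) → (Z → ℝ) → (ι → ℝ) → Prop)
    -- (G₃^{prof}) the third central moment kernel at the FAR corner-path law points `X s 1`; `Kh`-doubly-contracted column mass
    (𝒢₃ : ι → ι → ι → ℝ) (Kh : ι → ℝ) (NGh : ℝ) (hG0 : ∀ a b c, 0 ≤ 𝒢₃ a b c) (hKh0 : ∀ a, 0 ≤ Kh a) (hNGh : 0 ≤ NGh)
    (hGh : ∀ c, ∑ a, Kh a * (∑ b, Kh b * 𝒢₃ a b c) ≤ NGh)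
    (hCum : ∀ t : ℝ, 0 ≤ t → t ≤ 1 → ∀ (B B' : PBond (F.P j) 0) (m m' : Fin 3 → ℝ) (V00 V10 V01 V11 : GaugeField (F.P j) 0 ↥(Matrix.specialUnitaryGroup (Fin 2) ℂ)),
      ‖m‖ ≤ rc * (θBal F.L γ b₀ p₀ j / 4) → ‖m'‖ ≤ rc * (θBal F.L γ b₀ p₀ j / 4) → PlaqSmall (θBal F.L γ b₀ p₀ j / 4) V00 → PlaqSmall (θBal F.L γ b₀ p₀ j / 4) V10 → PlaqSmall (θBal F.L γ b₀ p₀ j / 4) V01 → PlaqSmall (θBal F.L γ b₀ p₀ j / 4) V11 →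
      (∀ e, e ≠ B → V10 e = V00 e) → V10 B = V00 B * expPt m → (∀ e, e ≠ B' → V01 e = V00 e) → V01 B' = V00 B' * expPt m' →
      (∀ e, e ≠ B' → V11 e = V10 e) → V11 B' = V10 B' * expPt m' →
      ∀ (Y : ℝ → GaugeField (F.P j) 0 ↥(Matrix.specialUnitaryGroup (Fin 2) ℂ)) (X : ℝ → ℝ → GaugeField (F.P j) 0 ↥(Matrix.specialUnitaryGroup (Fin 2) ℂ)),
      (∀ s e, e ≠ B → Y s e = V00 e) → (∀ s, Y s B = V00 B * expPt (s • m)) → (∀ s s' e, e ≠ B' → X s s' e = Y s e) → (∀ s s', X s s' B' = Y s B' * expPt (s' • m')) →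
      ∀ s ∈ Set.Icc (0:ℝ) 1, ∀ (Pf Qf Rf : Z → ℝ) (p q r : ι → ℝ), Prof (X s 1) Pf p → Prof (X s 1) Qf q → Prof (X s 1) Rf r → ∀ (cP cQ cR : ℝ),
        cP = ∫ z, Pf z * (wNum F γ b₀ p₀ j Ts ρ ρ' Φ J t (X s 1) z / ∫ z', wNum F γ b₀ p₀ j Ts ρ ρ' Φ J t (X s 1) z' ∂τ) ∂τ → cQ = ∫ z, Qf z * (wNum F γ b₀ p₀ j Ts ρ ρ' Φ J t (X s 1) z / ∫ z', wNum F γ b₀ p₀ j Ts ρ ρ' Φ J t (X s 1) z' ∂τ) ∂τ → cR = ∫ z, Rf z * (wNum F γ b₀ p₀ j Ts ρ ρ' Φ J t (X s 1) z / ∫ z', wNum F γ b₀ p₀ j Ts ρ ρ' Φ J t (X s 1) z' ∂τ) ∂τ →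
          Integrable (fun z => (Pf z - cP) * (Qf z - cQ) * (Rf z - cR) * (wNum F γ b₀ p₀ j Ts ρ ρ' Φ J t (X s 1) z / ∫ z', wNum F γ b₀ p₀ j Ts ρ ρ' Φ J t (X s 1) z' ∂τ)) τ ∧
            |∫ z, (Pf z - cP) * (Qf z - cQ) * (Rf z - cR) * (wNum F γ b₀ p₀ j Ts ρ ρ' Φ J t (X s 1) z / ∫ z', wNum F γ b₀ p₀ j Ts ρ ρ' Φ J t (X s 1) z' ∂τ) ∂τ| ≤ ∑ a, ∑ b, ∑ c, |p a| * |q b| * |r c| * 𝒢₃ a b c)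
    -- (G₃-Δ^{prof}) the INCREMENT of the displayed third cumulant of three FIXED profiled observables along the `B′`-edge `X s 0 → X s 1`; contracted edge mass
    (𝒢₃Δ : ι → ι → ι → PBond (F.P j) 0 → ℝ) (ωY : ι → PBond (F.P j) 0 → ℝ) (NΔ : ℝ) (hGΔ0 : ∀ a b c B', 0 ≤ 𝒢₃Δ a b c B') (hNΔ : 0 ≤ NΔ)
    (hGΔ : ∀ c, ∑ B', (∑ a, Kh a * (∑ b, Kh b * 𝒢₃Δ a b c B')) * ωY c B' ≤ NΔ)
    (hIncr : ∀ t : ℝ, 0 ≤ t → t ≤ 1 → ∀ (B B' : PBond (F.P j) 0) (m m' : Fin 3 → ℝ) (V00 V10 V01 V11 : GaugeField (F.P j) 0 ↥(Matrix.specialUnitaryGroup (Fin 2) ℂ)),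
      ‖m‖ ≤ rc * (θBal F.L γ b₀ p₀ j / 4) → ‖m'‖ ≤ rc * (θBal F.L γ b₀ p₀ j / 4) → PlaqSmall (θBal F.L γ b₀ p₀ j / 4) V00 → PlaqSmall (θBal F.L γ b₀ p₀ j / 4) V10 → PlaqSmall (θBal F.L γ b₀ p₀ j / 4) V01 → PlaqSmall (θBal F.L γ b₀ p₀ j / 4) V11 →
      (∀ e, e ≠ B → V10 e = V00 e) → V10 B = V00 B * expPt m → (∀ e, e ≠ B' → V01 e = V00 e) → V01 B' = V00 B' * expPt m' →
      (∀ e, e ≠ B' → V11 e = V10 e) → V11 B' = V10 B' * expPt m' →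
      ∀ (Y : ℝ → GaugeField (F.P j) 0 ↥(Matrix.specialUnitaryGroup (Fin 2) ℂ)) (X : ℝ → ℝ → GaugeField (F.P j) 0 ↥(Matrix.specialUnitaryGroup (Fin 2) ℂ)),
      (∀ s e, e ≠ B → Y s e = V00 e) → (∀ s, Y s B = V00 B * expPt (s • m)) → (∀ s s' e, e ≠ B' → X s s' e = Y s e) → (∀ s s', X s s' B' = Y s B' * expPt (s' • m')) →
      ∀ s ∈ Set.Icc (0:ℝ) 1, ∀ (Pf Qf Rf : Z → ℝ) (p q r : ι → ℝ), Prof (X s 0) Pf p → Prof (X s 0) Qf q → Prof (X s 0) Rf r →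
        |((((∫ z, Pf z * Qf z * Rf z * (wNum F γ b₀ p₀ j Ts ρ ρ' Φ J t (X s 1) z / ∫ z', wNum F γ b₀ p₀ j Ts ρ ρ' Φ J t (X s 1) z' ∂τ) ∂τ) - (∫ z, Pf z * Qf z * (wNum F γ b₀ p₀ j Ts ρ ρ' Φ J t (X s 1) z / ∫ z', wNum F γ b₀ p₀ j Ts ρ ρ' Φ J t (X s 1) z' ∂τ) ∂τ) * (∫ z, Rf z * (wNum F γ b₀ p₀ j Ts ρ ρ' Φ J t (X s 1) z / ∫ z', wNum F γ b₀ p₀ j Ts ρ ρ' Φ J t (X s 1) z' ∂τ) ∂τ))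
                - (((∫ z, Pf z * Rf z * (wNum F γ b₀ p₀ j Ts ρ ρ' Φ J t (X s 1) z / ∫ z', wNum F γ b₀ p₀ j Ts ρ ρ' Φ J t (X s 1) z' ∂τ) ∂τ) - (∫ z, Pf z * (wNum F γ b₀ p₀ j Ts ρ ρ' Φ J t (X s 1) z / ∫ z', wNum F γ b₀ p₀ j Ts ρ ρ' Φ J t (X s 1) z' ∂τ) ∂τ) * (∫ z, Rf z * (wNum F γ b₀ p₀ j Ts ρ ρ' Φ J t (X s 1) z / ∫ z', wNum F γ b₀ p₀ j Ts ρ ρ' Φ J t (X s 1) z' ∂τ) ∂τ)) * (∫ z, Qf z * (wNum F γ b₀ p₀ j Ts ρ ρ' Φ J t (X s 1) z / ∫ z', wNum F γ b₀ p₀ j Ts ρ ρ' Φ J t (X s 1) z' ∂τ) ∂τ)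
                    + (∫ z, Pf z * (wNum F γ b₀ p₀ j Ts ρ ρ' Φ J t (X s 1) z / ∫ z', wNum F γ b₀ p₀ j Ts ρ ρ' Φ J t (X s 1) z' ∂τ) ∂τ) * ((∫ z, Qf z * Rf z * (wNum F γ b₀ p₀ j Ts ρ ρ' Φ J t (X s 1) z / ∫ z', wNum F γ b₀ p₀ j Ts ρ ρ' Φ J t (X s 1) z' ∂τ) ∂τ) - (∫ z, Qf z * (wNum F γ b₀ p₀ j Ts ρ ρ' Φ J t (X s 1) z / ∫ z', wNum F γ b₀ p₀ j Ts ρ ρ' Φ J t (X s 1) z' ∂τ) ∂τ) * (∫ z, Rf z * (wNum F γ b₀ p₀ j Ts ρ ρ' Φ J t (X s 1) z / ∫ z', wNum F γ b₀ p₀ j Ts ρ ρ' Φ J t (X s 1) z' ∂τ) ∂τ)))))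
            - ((((∫ z, Pf z * Qf z * Rf z * (wNum F γ b₀ p₀ j Ts ρ ρ' Φ J t (X s 0) z / ∫ z', wNum F γ b₀ p₀ j Ts ρ ρ' Φ J t (X s 0) z' ∂τ) ∂τ) - (∫ z, Pf z * Qf z * (wNum F γ b₀ p₀ j Ts ρ ρ' Φ J t (X s 0) z / ∫ z', wNum F γ b₀ p₀ j Ts ρ ρ' Φ J t (X s 0) z' ∂τ) ∂τ) * (∫ z, Rf z * (wNum F γ b₀ p₀ j Ts ρ ρ' Φ J t (X s 0) z / ∫ z', wNum F γ b₀ p₀ j Ts ρ ρ' Φ J t (X s 0) z' ∂τ) ∂τ))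
                - (((∫ z, Pf z * Rf z * (wNum F γ b₀ p₀ j Ts ρ ρ' Φ J t (X s 0) z / ∫ z', wNum F γ b₀ p₀ j Ts ρ ρ' Φ J t (X s 0) z' ∂τ) ∂τ) - (∫ z, Pf z * (wNum F γ b₀ p₀ j Ts ρ ρ' Φ J t (X s 0) z / ∫ z', wNum F γ b₀ p₀ j Ts ρ ρ' Φ J t (X s 0) z' ∂τ) ∂τ) * (∫ z, Rf z * (wNum F γ b₀ p₀ j Ts ρ ρ' Φ J t (X s 0) z / ∫ z', wNum F γ b₀ p₀ j Ts ρ ρ' Φ J t (X s 0) z' ∂τ) ∂τ)) * (∫ z, Qf z * (wNum F γ b₀ p₀ j Ts ρ ρ' Φ J t (X s 0) z / ∫ z', wNum F γ b₀ p₀ j Ts ρ ρ' Φ J t (X s 0) z' ∂τ) ∂τ)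
                    + (∫ z, Pf z * (wNum F γ b₀ p₀ j Ts ρ ρ' Φ J t (X s 0) z / ∫ z', wNum F γ b₀ p₀ j Ts ρ ρ' Φ J t (X s 0) z' ∂τ) ∂τ) * ((∫ z, Qf z * Rf z * (wNum F γ b₀ p₀ j Ts ρ ρ' Φ J t (X s 0) z / ∫ z', wNum F γ b₀ p₀ j Ts ρ ρ' Φ J t (X s 0) z' ∂τ) ∂τ) - (∫ z, Qf z * (wNum F γ b₀ p₀ j Ts ρ ρ' Φ J t (X s 0) z / ∫ z', wNum F γ b₀ p₀ j Ts ρ ρ' Φ J t (X s 0) z' ∂τ) ∂τ) * (∫ z, Rf z * (wNum F γ b₀ p₀ j Ts ρ ρ' Φ J t (X s 0) z / ∫ z', wNum F γ b₀ p₀ j Ts ρ ρ' Φ J t (X s 0) z' ∂τ) ∂τ)))))|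
          ≤ ‖m'‖ / (θBal F.L γ b₀ p₀ j / 4) * ∑ a, ∑ b, ∑ c, |p a| * |q b| * |r c| * 𝒢₃Δ a b c B')
    -- (SC-PROF-L) ∕ (SC-Δ-PROF): profiles of the score on the near path and of the MIXED score increment; masses
    (Q₁ : ι → PBond (F.P j) 0 → ℝ) (Q₂ : ι → PBond (F.P j) 0 → PBond (F.P j) 0 → ℝ) (ωX : ι → PBond (F.P j) 0 → ℝ) (Nrow N₂ : ℝ)
    (hQ10 : ∀ c B, 0 ≤ Q₁ c B) (hQ20 : ∀ c B B', 0 ≤ Q₂ c B B') (hωX : ∀ c B, 0 ≤ ωX c B)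
    (hQcol : ∀ B, ∑ c, Q₁ c B * ωX c B ≤ Nrow) (hQ2 : ∀ B, ∑ c, ∑ B', Q₂ c B B' * Real.exp (κ * (B.src.tdist B'.src : ℝ)) ≤ N₂)
    (htri : ∀ (B B' : PBond (F.P j) 0) (c : ι), Real.exp (κ * (B.src.tdist B'.src : ℝ)) ≤ ωX c B * ωY c B')
    -- (h-PROF) ∧ (SC-PROF-L) ∧ (SC-Δ-PROF) at the square law points
    (hProfF : ∀ t : ℝ, 0 ≤ t → t ≤ 1 → ∀ (B B' : PBond (F.P j) 0) (m m' : Fin 3 → ℝ) (V00 V10 V01 V11 : GaugeField (F.P j) 0 ↥(Matrix.specialUnitaryGroup (Fin 2) ℂ)),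
      ‖m‖ ≤ rc * (θBal F.L γ b₀ p₀ j / 4) → ‖m'‖ ≤ rc * (θBal F.L γ b₀ p₀ j / 4) → PlaqSmall (θBal F.L γ b₀ p₀ j / 4) V00 → PlaqSmall (θBal F.L γ b₀ p₀ j / 4) V10 → PlaqSmall (θBal F.L γ b₀ p₀ j / 4) V01 → PlaqSmall (θBal F.L γ b₀ p₀ j / 4) V11 →
      (∀ e, e ≠ B → V10 e = V00 e) → V10 B = V00 B * expPt m → (∀ e, e ≠ B' → V01 e = V00 e) → V01 B' = V00 B' * expPt m' →
      (∀ e, e ≠ B' → V11 e = V10 e) → V11 B' = V10 B' * expPt m' →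
      ∀ (Y : ℝ → GaugeField (F.P j) 0 ↥(Matrix.specialUnitaryGroup (Fin 2) ℂ)) (X : ℝ → ℝ → GaugeField (F.P j) 0 ↥(Matrix.specialUnitaryGroup (Fin 2) ℂ)),
      (∀ s e, e ≠ B → Y s e = V00 e) → (∀ s, Y s B = V00 B * expPt (s • m)) → (∀ s s' e, e ≠ B' → X s s' e = Y s e) → (∀ s s', X s s' B' = Y s B' * expPt (s' • m')) →
      ∀ s ∈ Set.Icc (0:ℝ) 1,
        Prof (X s 1) (fun z => (Real.log (ρ Ts (Φ (V00, z))) - Real.log (ρ' Ts (Φ (V00, z))))) Kh ∧ Prof (X s 0) (fun z => (Real.log (ρ Ts (Φ (V00, z))) - Real.log (ρ' Ts (Φ (V00, z))))) Kh ∧ Prof (X s 0) (fun z => deriv (fun s => wNum F γ b₀ p₀ j Ts ρ ρ' Φ J t (X s 0) z) s / wNum F γ b₀ p₀ j Ts ρ ρ' Φ J t (X s 0) z) (fun a => ‖m‖ / (θBal F.L γ b₀ p₀ j / 4) * Q₁ a B) ∧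
          Prof (X s 1) (fun z => (deriv (fun s => wNum F γ b₀ p₀ j Ts ρ ρ' Φ J t (X s 1) z) s / wNum F γ b₀ p₀ j Ts ρ ρ' Φ J t (X s 1) z) - (deriv (fun s => wNum F γ b₀ p₀ j Ts ρ ρ' Φ J t (X s 0) z) s / wNum F γ b₀ p₀ j Ts ρ ρ' Φ J t (X s 0) z)) (fun a => ‖m‖ / (θBal F.L γ b₀ p₀ j / 4) * (‖m'‖ / (θBal F.L γ b₀ p₀ j / 4)) * Q₂ a B B'))
    -- the law facts at the far corner-path law points, a.e. in the path parameter
    (hlaw : ∀ t : ℝ, 0 ≤ t → t ≤ 1 → ∀ (B B' : PBond (F.P j) 0) (m m' : Fin 3 → ℝ) (V00 V10 V01 V11 : GaugeField (F.P j) 0 ↥(Matrix.specialUnitaryGroup (Fin 2) ℂ)),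
      ‖m‖ ≤ rc * (θBal F.L γ b₀ p₀ j / 4) → ‖m'‖ ≤ rc * (θBal F.L γ b₀ p₀ j / 4) → PlaqSmall (θBal F.L γ b₀ p₀ j / 4) V00 → PlaqSmall (θBal F.L γ b₀ p₀ j / 4) V10 → PlaqSmall (θBal F.L γ b₀ p₀ j / 4) V01 → PlaqSmall (θBal F.L γ b₀ p₀ j / 4) V11 →
      (∀ e, e ≠ B → V10 e = V00 e) → V10 B = V00 B * expPt m → (∀ e, e ≠ B' → V01 e = V00 e) → V01 B' = V00 B' * expPt m' →
      (∀ e, e ≠ B' → V11 e = V10 e) → V11 B' = V10 B' * expPt m' →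
      ∀ (Y : ℝ → GaugeField (F.P j) 0 ↥(Matrix.specialUnitaryGroup (Fin 2) ℂ)) (X : ℝ → ℝ → GaugeField (F.P j) 0 ↥(Matrix.specialUnitaryGroup (Fin 2) ℂ)),
      (∀ s e, e ≠ B → Y s e = V00 e) → (∀ s, Y s B = V00 B * expPt (s • m)) → (∀ s s' e, e ≠ B' → X s s' e = Y s e) → (∀ s s', X s s' B' = Y s B' * expPt (s' • m')) →
      ∀ᵐ s ∂(volume : Measure ℝ), s ∈ Set.Icc (0:ℝ) 1 →
        Integrable (fun z => (wNum F γ b₀ p₀ j Ts ρ ρ' Φ J t (X s 1) z / ∫ z', wNum F γ b₀ p₀ j Ts ρ ρ' Φ J t (X s 1) z' ∂τ)) τ ∧ ∫ z, (wNum F γ b₀ p₀ j Ts ρ ρ' Φ J t (X s 1) z / ∫ z', wNum F γ b₀ p₀ j Ts ρ ρ' Φ J t (X s 1) z' ∂τ) ∂τ = 1 ∧ Integrable (fun z => (Real.log (ρ Ts (Φ (V00, z))) - Real.log (ρ' Ts (Φ (V00, z)))) * (wNum F γ b₀ p₀ j Ts ρ ρ' Φ J t (X s 1) z / ∫ z',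 wNum F γ b₀ p₀ j Ts ρ ρ' Φ J t (X s 1) z' ∂τ)) τ ∧
        Integrable (fun z => (deriv (fun s => wNum F γ b₀ p₀ j Ts ρ ρ' Φ J t (X s 1) z) s / wNum F γ b₀ p₀ j Ts ρ ρ' Φ J t (X s 1) z) * (wNum F γ b₀ p₀ j Ts ρ ρ' Φ J t (X s 1) z / ∫ z', wNum F γ b₀ p₀ j Ts ρ ρ' Φ J t (X s 1) z' ∂τ)) τ ∧ Integrable (fun z => (deriv (fun s => wNum F γ b₀ p₀ j Ts ρ ρ' Φ J t (X s 0) z) s / wNum F γ b₀ p₀ j Ts ρ ρ' Φ J t (X s 0) z) * (wNum F γ b₀ p₀ j Ts ρ ρ' Φ J t (X s 1) z / ∫ z', wNum F γ b₀ p₀ j Ts ρ ρ' Φ J t (X s 1) z' ∂τ)) τ ∧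
        Integrable (fun z => (Real.log (ρ Ts (Φ (V00, z))) - Real.log (ρ' Ts (Φ (V00, z)))) * (Real.log (ρ Ts (Φ (V00, z))) - Real.log (ρ' Ts (Φ (V00, z)))) * (wNum F γ b₀ p₀ j Ts ρ ρ' Φ J t (X s 1) z / ∫ z', wNum F γ b₀ p₀ j Ts ρ ρ' Φ J t (X s 1) z' ∂τ)) τ ∧
        Integrable (fun z => (Real.log (ρ Ts (Φ (V00, z))) - Real.log (ρ' Ts (Φ (V00, z)))) * (deriv (fun s => wNum F γ b₀ p₀ j Ts ρ ρ' Φ J t (X s 1) z) s / wNum F γ b₀ p₀ j Ts ρ ρ' Φ J t (X s 1) z) * (wNum F γ b₀ p₀ j Ts ρ ρ' Φ J t (X s 1) z / ∫ z', wNum F γ b₀ p₀ j Ts ρ ρ' Φ J t (X s 1) z' ∂τ)) τ ∧ Integrable (fun z => (Real.log (ρ Ts (Φ (V00, z))) - Real.log (ρ' Ts (Φ (V00, z)))) * (deriv (fun s => wNum F γ b₀ p₀ j Ts ρ ρ' Φ J t (X s 0) z) s / wNum F γ b₀ p₀ j Ts ρ ρ' Φ J t (X s 0) z) * (wNum F γ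 b₀ p₀ j Ts ρ ρ' Φ J t (X s 1) z / ∫ z', wNum F γ b₀ p₀ j Ts ρ ρ' Φ J t (X s 1) z' ∂τ)) τ ∧
        Integrable (fun z => (Real.log (ρ Ts (Φ (V00, z))) - Real.log (ρ' Ts (Φ (V00, z)))) * (Real.log (ρ Ts (Φ (V00, z))) - Real.log (ρ' Ts (Φ (V00, z)))) * (deriv (fun s => wNum F γ b₀ p₀ j Ts ρ ρ' Φ J t (X s 1) z) s / wNum F γ b₀ p₀ j Ts ρ ρ' Φ J t (X s 1) z) * (wNum F γ b₀ p₀ j Ts ρ ρ' Φ J t (X s 1) z / ∫ z', wNum F γ b₀ p₀ j Ts ρ ρ' Φ J t (X s 1) z' ∂τ)) τ ∧ Integrable (fun z => (Real.log (ρ Ts (Φ (V00, z))) - Real.log (ρ' Ts (Φ (V00, z)))) * (Real.log (ρ Ts (Φ (V00, z))) - Real.log (ρ' Ts (Φ (V00, z)))) * (deriv (fun s => wNum F γ b₀ p₀ j Ts ρ ρ' Φ J t (X s 0) z) s / wNum F γ b₀ p₀ j Ts ρ ρ' Φ J t (X s 0) z) * (wNum F γ b₀ p₀ j Ts ρ ρ'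 Φ J t (X s 1) z / ∫ z', wNum F γ b₀ p₀ j Ts ρ ρ' Φ J t (X s 1) z' ∂τ)) τ)
    (hM : NGh * N₂ + NΔ * Nrow ≤ M) :
    ∃ kV₄ : PBond (F.P j) 0 → PBond (F.P j) 0 → ℝ, (∀ B B', 0 ≤ kV₄ B B') ∧
      (∀ B, ∑ B', kV₄ B B' * Real.exp (κ * (B.src.tdist B'.src : ℝ)) ≤ M) ∧
      ∀ t : ℝ, 0 ≤ t → t ≤ 1 → ∀ (B B' : PBond (F.P j) 0) (m m' : Fin 3 → ℝ) (V00 V10 V01 V11 : GaugeField (F.P j) 0 ↥(Matrix.specialUnitaryGroup (Fin 2) ℂ)),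
        ‖m‖ ≤ rc * (θBal F.L γ b₀ p₀ j / 4) → ‖m'‖ ≤ rc * (θBal F.L γ b₀ p₀ j / 4) → PlaqSmall (θBal F.L γ b₀ p₀ j / 4) V00 → PlaqSmall (θBal F.L γ b₀ p₀ j / 4) V10 → PlaqSmall (θBal F.L γ b₀ p₀ j / 4) V01 → PlaqSmall (θBal F.L γ b₀ p₀ j / 4) V11 →
        (∀ e, e ≠ B → V10 e = V00 e) → V10 B = V00 B * expPt m → (∀ e, e ≠ B' → V01 e = V00 e) → V01 B' = V00 B' * expPt m' →
        (∀ e, e ≠ B' → V11 e = V10 e) → V11 B' = V10 B' * expPt m' →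
        ∀ (Y : ℝ → GaugeField (F.P j) 0 ↥(Matrix.specialUnitaryGroup (Fin 2) ℂ)) (X : ℝ → ℝ → GaugeField (F.P j) 0 ↥(Matrix.specialUnitaryGroup (Fin 2) ℂ)),
        (∀ s e, e ≠ B → Y s e = V00 e) → (∀ s, Y s B = V00 B * expPt (s • m)) → (∀ s s' e, e ≠ B' → X s s' e = Y s e) → (∀ s s', X s s' B' = Y s B' * expPt (s' • m')) →
        (∀ᵐ s ∂(volume : Measure ℝ), s ∈ Set.Icc (0:ℝ) 1 → |(((∫ z, ((Real.log (ρ Ts (Φ (V00, z))) - Real.log (ρ' Ts (Φ (V00, z)))) * (Real.log (ρ Ts (Φ (V00, z))) - Real.log (ρ' Ts (Φ (V00, z))))) * (deriv (fun s => wNum F γ b₀ p₀ j Ts ρ ρ' Φ J t (X s 1) z) s / wNum F γ b₀ p₀ j Ts ρ ρ' Φ J t (X s 1) z) * (wNum F γ b₀ p₀ j Ts ρ ρ' Φ J t (X s 1) z / ∫ z', wNum F γ b₀ p₀ j Ts ρ ρ' Φ J t (X s 1) z' ∂τ) ∂τ) - (∫ z, ((Real.log (ρ Ts (Φ (V00,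 z))) - Real.log (ρ' Ts (Φ (V00, z)))) * (Real.log (ρ Ts (Φ (V00, z))) - Real.log (ρ' Ts (Φ (V00, z))))) * (wNum F γ b₀ p₀ j Ts ρ ρ' Φ J t (X s 1) z / ∫ z', wNum F γ b₀ p₀ j Ts ρ ρ' Φ J t (X s 1) z' ∂τ) ∂τ) * (∫ z, (deriv (fun s => wNum F γ b₀ p₀ j Ts ρ ρ' Φ J t (X s 1) z) s / wNum F γ b₀ p₀ j Ts ρ ρ' Φ J t (X s 1) z) * (wNum F γ b₀ p₀ j Ts ρ ρ' Φ J t (X s 1) z / ∫ z', wNum F γ b₀ p₀ j Ts ρ ρ' Φ J t (X s 1) z' ∂τ) ∂τ))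
                  - (((∫ z, (Real.log (ρ Ts (Φ (V00, z))) - Real.log (ρ' Ts (Φ (V00, z)))) * (deriv (fun s => wNum F γ b₀ p₀ j Ts ρ ρ' Φ J t (X s 1) z) s / wNum F γ b₀ p₀ j Ts ρ ρ' Φ J t (X s 1) z) * (wNum F γ b₀ p₀ j Ts ρ ρ' Φ J t (X s 1) z / ∫ z', wNum F γ b₀ p₀ j Ts ρ ρ' Φ J t (X s 1) z' ∂τ) ∂τ) - (∫ z, (Real.log (ρ Ts (Φ (V00, z))) - Real.log (ρ' Ts (Φ (V00, z)))) * (wNum F γ b₀ p₀ j Ts ρ ρ' Φ J t (X s 1) z / ∫ z', wNum F γ b₀ p₀ j Ts ρ ρ' Φ J t (X s 1) z' ∂τ) ∂τ) * (∫ z, (deriv (fun s => wNum F γ b₀ p₀ j Ts ρ ρ' Φ J t (X s 1) z) s / wNum F γ b₀ p₀ j Ts ρ ρ' Φ J t (X s 1) z) * (wNum F γ b₀ p₀ j Ts ρ ρ' Φ J t (X s 1) z / ∫ z', wNum F γ b₀ p₀ j Ts ρ ρ' Φ J t (X s 1) z' ∂τ) ∂τ)) * (∫ z, (Real.log (ρ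 Ts (Φ (V00, z))) - Real.log (ρ' Ts (Φ (V00, z)))) * (wNum F γ b₀ p₀ j Ts ρ ρ' Φ J t (X s 1) z / ∫ z', wNum F γ b₀ p₀ j Ts ρ ρ' Φ J t (X s 1) z' ∂τ) ∂τ)
                    + (∫ z, (Real.log (ρ Ts (Φ (V00, z))) - Real.log (ρ' Ts (Φ (V00, z)))) * (wNum F γ b₀ p₀ j Ts ρ ρ' Φ J t (X s 1) z / ∫ z', wNum F γ b₀ p₀ j Ts ρ ρ' Φ J t (X s 1) z' ∂τ) ∂τ) * ((∫ z, (Real.log (ρ Ts (Φ (V00, z))) - Real.log (ρ' Ts (Φ (V00, z)))) * (deriv (fun s => wNum F γ b₀ p₀ j Ts ρ ρ' Φ J t (X s 1) z) s / wNum F γ b₀ p₀ j Ts ρ ρ' Φ J t (X s 1) z) * (wNum F γ b₀ p₀ j Ts ρ ρ' Φ J t (X s 1) z / ∫ z', wNum F γ b₀ p₀ j Ts ρ ρ' Φ J t (X s 1) z' ∂τ) ∂τ) - (∫ z, (Real.log (ρ Ts (Φ (V00, z))) - Real.log (ρ' Ts (Φ (V00, z)))) * (wNum F γ b₀ p₀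 j Ts ρ ρ' Φ J t (X s 1) z / ∫ z', wNum F γ b₀ p₀ j Ts ρ ρ' Φ J t (X s 1) z' ∂τ) ∂τ) * (∫ z, (deriv (fun s => wNum F γ b₀ p₀ j Ts ρ ρ' Φ J t (X s 1) z) s / wNum F γ b₀ p₀ j Ts ρ ρ' Φ J t (X s 1) z) * (wNum F γ b₀ p₀ j Ts ρ ρ' Φ J t (X s 1) z / ∫ z', wNum F γ b₀ p₀ j Ts ρ ρ' Φ J t (X s 1) z' ∂τ) ∂τ))))
                - (((∫ z, ((Real.log (ρ Ts (Φ (V00, z))) - Real.log (ρ' Ts (Φ (V00, z)))) * (Real.log (ρ Ts (Φ (V00, z))) - Real.log (ρ' Ts (Φ (V00, z))))) * (deriv (fun s => wNum F γ b₀ p₀ j Ts ρ ρ' Φ J t (X s 0) z) s / wNum F γ b₀ p₀ j Ts ρ ρ' Φ J t (X s 0) z) * (wNum F γ b₀ p₀ j Ts ρ ρ' Φ J t (X s 0) z / ∫ z', wNum F γ b₀ p₀ j Ts ρ ρ' Φ J t (X s 0) z' ∂τ) ∂τ) - (∫ z, ((Real.log (ρ Ts (Φ (V00, z))) - Real.log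 (ρ' Ts (Φ (V00, z)))) * (Real.log (ρ Ts (Φ (V00, z))) - Real.log (ρ' Ts (Φ (V00, z))))) * (wNum F γ b₀ p₀ j Ts ρ ρ' Φ J t (X s 0) z / ∫ z', wNum F γ b₀ p₀ j Ts ρ ρ' Φ J t (X s 0) z' ∂τ) ∂τ) * (∫ z, (deriv (fun s => wNum F γ b₀ p₀ j Ts ρ ρ' Φ J t (X s 0) z) s / wNum F γ b₀ p₀ j Ts ρ ρ' Φ J t (X s 0) z) * (wNum F γ b₀ p₀ j Ts ρ ρ' Φ J t (X s 0) z / ∫ z', wNum F γ b₀ p₀ j Ts ρ ρ' Φ J t (X s 0) z' ∂τ) ∂τ))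
                  - (((∫ z, (Real.log (ρ Ts (Φ (V00, z))) - Real.log (ρ' Ts (Φ (V00, z)))) * (deriv (fun s => wNum F γ b₀ p₀ j Ts ρ ρ' Φ J t (X s 0) z) s / wNum F γ b₀ p₀ j Ts ρ ρ' Φ J t (X s 0) z) * (wNum F γ b₀ p₀ j Ts ρ ρ' Φ J t (X s 0) z / ∫ z', wNum F γ b₀ p₀ j Ts ρ ρ' Φ J t (X s 0) z' ∂τ) ∂τ) - (∫ z, (Real.log (ρ Ts (Φ (V00, z))) - Real.log (ρ' Ts (Φ (V00, z)))) * (wNum F γ b₀ p₀ j Ts ρ ρ' Φ J t (X s 0) z / ∫ z', wNum F γ b₀ p₀ j Ts ρ ρ' Φ J t (X s 0) z' ∂τ) ∂τ) * (∫ z, (deriv (fun s => wNum F γ b₀ p₀ j Ts ρ ρ' Φ J t (X s 0) z) s / wNum F γ b₀ p₀ j Ts ρ ρ' Φ J t (X s 0) z) * (wNum F γ b₀ p₀ j Ts ρ ρ' Φ J t (X s 0) z / ∫ z', wNum F γ b₀ p₀ j Ts ρ ρ' Φ J t (X s 0) z' ∂τ) ∂τ)) * (∫ z, (Real.log (ρ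 Ts (Φ (V00, z))) - Real.log (ρ' Ts (Φ (V00, z)))) * (wNum F γ b₀ p₀ j Ts ρ ρ' Φ J t (X s 0) z / ∫ z', wNum F γ b₀ p₀ j Ts ρ ρ' Φ J t (X s 0) z' ∂τ) ∂τ)
                    + (∫ z, (Real.log (ρ Ts (Φ (V00, z))) - Real.log (ρ' Ts (Φ (V00, z)))) * (wNum F γ b₀ p₀ j Ts ρ ρ' Φ J t (X s 0) z / ∫ z', wNum F γ b₀ p₀ j Ts ρ ρ' Φ J t (X s 0) z' ∂τ) ∂τ) * ((∫ z, (Real.log (ρ Ts (Φ (V00, z))) - Real.log (ρ' Ts (Φ (V00, z)))) * (deriv (fun s => wNum F γ b₀ p₀ j Ts ρ ρ' Φ J t (X s 0) z) s / wNum F γ b₀ p₀ j Ts ρ ρ' Φ J t (X s 0) z) * (wNum F γ b₀ p₀ j Ts ρ ρ' Φ J t (X s 0) z / ∫ z', wNum F γ b₀ p₀ j Ts ρ ρ' Φ J t (X s 0) z' ∂τ) ∂τ) - (∫ z, (Real.log (ρ Ts (Φ (V00, z))) - Real.log (ρ' Ts (Φ (V00, z)))) * (wNum F γ b₀ p₀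 j Ts ρ ρ' Φ J t (X s 0) z / ∫ z', wNum F γ b₀ p₀ j Ts ρ ρ' Φ J t (X s 0) z' ∂τ) ∂τ) * (∫ z, (deriv (fun s => wNum F γ b₀ p₀ j Ts ρ ρ' Φ J t (X s 0) z) s / wNum F γ b₀ p₀ j Ts ρ ρ' Φ J t (X s 0) z) * (wNum F γ b₀ p₀ j Ts ρ ρ' Φ J t (X s 0) z / ∫ z', wNum F γ b₀ p₀ j Ts ρ ρ' Φ J t (X s 0) z' ∂τ) ∂τ))))| ≤ kV₄ B B' * (‖m‖ / (θBal F.L γ b₀ p₀ j / 4)) * (‖m'‖ / (θBal F.L γ b₀ p₀ j / 4))) := by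
  exact kerV4Clause_of_cum3Kernel_increment_profiles τ
    (fun V z => Real.log (ρ Ts (Φ (V, z))) - Real.log (ρ' Ts (Φ (V, z))))
    (fun t Xw z => wNum F γ b₀ p₀ j Ts ρ ρ' Φ J t Xw z / ∫ z', wNum F γ b₀ p₀ j Ts ρ ρ' Φ J t Xw z' ∂τ)
    (fun t X' s z => deriv (fun s => wNum F γ b₀ p₀ j Ts ρ ρ' Φ J t (X' s) z) s / wNum F γ b₀ p₀ j Ts ρ ρ' Φ J t (X' s) z)
    (θBal F.L γ b₀ p₀ j / 4) rc κ M (by positivity) Prof 𝒢₃ Kh NGh hG0 hKh0 hNGh hGh hCum 𝒢₃Δ ωY NΔ hGΔ0 hNΔ hGΔ hIncr Q₁ Q₂ ωX Nrow N₂ hQ10 hQ20 hωX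
    hQcol hQ2 htri hProfF hlaw hM

end Organ

end Summit.QuantumFields.YangMills.Theorems.OrganTangentILawKerV4OfScoreProfile

end
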